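import Summits.QuantumFields.BalabanUV.Beta.GAN24.CombBornSector
import Summits.QuantumFields.BalabanUV.Beta.GAN24.BornBorderLineage

/-!
# The (III′) V-born (BORDER) sector of the comb-chart remainder: the V-source in units is `cVH • tabs.V` at EVERY level, its one-step image is the two mixed
# channels of the four-channel read ON THE TRANSPORTED TABLE `𝒯 (cVH • tabs.V)`, and the V-born remainder in units is the fresh source plus the transported images

NOT IN PRINT — OUR BOOKKEEPING (road-P2 = `b2b-balaban-gan24-p2` gen 56, 2026-08-25; row G-an2-4 ∕ (CONV-C), the (α-0) chain at row D1's literal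
OF RECORD (III′) `JsB12CombShSym`; [folklore] composition BY NAME; 0 `def`, 0 cite, 0 `def … : Prop`, 0 `sorry`).  Weight 0.  NEVER «G-an2-4 closed» as (CONV-C);
NOT D1, NOT BetaPertH, NOT continuum, NOT Clay; NO campaign opened (an2 W-4).

This is the (III′) twin of leaf-01 g59's (E) `GAN24/BornBorderLineage` (the V-born = BORDER sector, instance side) over M.51 `CombBornSector` (`combFreshAt ∕ combStepMap ∕
combUnitStepMap`, `unitS_combBornOf_eq_sum`), at `cΛ = 0`, for any sym record `tabs : SymTables d Lc` whose border table is OFF-DIAGONAL (`hVff hVmm` displayed: no field–field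
and no multiplier–multiplier block — the shape of an1's `symVhSAt`, as (E)'s `vhSAt_inl_inl ∕ vhSAt_inr_inr`).  Notation: `ρ_c = ctr (d+1) Lc`, `Ψ̂ = psiKS (ctrOff (d+1) Lc) Lc`,
`𝒯 Y κ u = Ψ̂ᵀ ∘ slotPsiS Y κ u ∘ Ψ̂`, `R_i = respStepBm ρ_c Lc (Lc^i) (Lc^(i+1))` (`= respStepBmSeq ρ_c Lc i`), `K̃_i = KStepUnit Lc i`, `c₃ = cE·Lc^{2(d+1)}`.
The import of the (E) twin is for the DESCENDANTS (it carries `BornLambdaLineage ∕ FibreStrip ∕ ContactKernelCells ∕ StencilSlotVHRoot` to M.58's Λ-lineage); no (E) symbol is used below.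
* §0 `unitS_combBornOf_eq_sum_range` — M.51's closed form re-indexed: `unitS_k (combBornOf k) = Σ_{i ≤ k} transport combUnitStepMap i (k−i) (unitS_i (combFreshAt i))` (any `cΛ`).
* §1 THE V-SOURCE IN UNITS: `combFreshAt_v_zero ∕ _succ`, **`unitS_combFreshAt_v`** (`unitS_j (combFreshAt tabs cVH 0 j) = cVH • tabs.V` for EVERY `j` — asym1's `unitS_one`;
  the OWNER's `StencilSlotVH.unitS_smul_offDiag` + `vh_unit_factor`: the weight `wVH j` cancels against the adopted units exactly), **`exists_hX_v`** (UNCONDITIONAL `j`-uniform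
  locality at every rate: the record's letter (LV) `tabs.hV`).
* §2 `𝒯` KEEPS THE BORDER SHAPE: `transport_inl_inl_eq_zero ∕ transport_inr_inr_eq_zero` (an off-diagonal table stays off-diagonal under `𝒯`: M.46 `transport_inl_inl` + d1-leaf-03's
  `comp_psiKS_inr_right ∕ comp_trK_psiKS_inr_left`), `reslot_inl_inl_transport ∕ reslot_inr_inr_transport`; THE ONE-STEP IMAGE **`combUnitStepMap_v_eq_two_push₃`** —
  `combUnitStepMap Lc cE i (cVH • tabs.V) = c₃ • (−(push₃ (−R_i) (colM K̃_i Lc) R_i (reslot inl inr (𝒯 (cVH • V))) + push₃ (rowMM K̃_i Lc) R_i R_i (reslot inr inl (𝒯 (cVH • V)))))` —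
  leaf-01 g43's four-channel read `RespStepBm.e3K_coDressKBmAt_KStepUnit` ON `𝒯 (cVH • V)` with the two diagonal channels killed (the (E) statement with `vhSAt ρ ↦ 𝒯 (cVH • tabs.V)`);
  `isFF_ ∕ isLoc_combUnitStepMap_v`.
* §3 **`unitS_combBornV_eq_sum`** ∕ **`unitS_combBornV_eq_sum_push₃`**: `unitS_k (combBornOf Lc tabs cE cVH 0 k) = cVH • tabs.V + Σ_{i<k} transport combUnitStepMap (i+1) (k−1−i) X_i`,
  `X_i := combUnitStepMap Lc cE i (cVH • tabs.V)`, and for member `k+1` every transport of `≥ 1` step is `c₃^{k−i} • push₃ T″_i T″_i T″_i X_i`,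
  `T″_i = legChain (fun j ↦ legComp ψ♭ R_j) (i+1) (k−1−i)` (M.51 `transport_combUnitStepMap_succ_eq_push₃` at base `i+1`) — the (E) `unitS_bornV_eq_sum(_push₃)` token for token with
  `vhSAt ρ ↦ tabs.V`, `unitStepMap ρ ↦ combUnitStepMap`, `respStepBmSeq ρ ↦ fun j ↦ legComp ψ♭ (respStepBmSeq ρ_c Lc j)`.
NO undressed ∕ contact split is typed here (as at (E): a design choice of the V-campaign); discharges NO slot letter; asserts NO shape of Bałaban's stencils; 0 wall binders.
-/

noncomputable section

open Finset
open scoped BigOperators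
open Literature.MathematicalPhysics.QuantumFieldTheory
open Literature.MathematicalPhysics.QuantumFieldTheory.Balaban1983to89
open Literature.MathematicalPhysics.QuantumFieldTheory.Balaban1983to89.Beta
open ExpKernelCalculus (MKer Decays comp)
open AffineAveraging (Site box toSite)
open AveragingContoursRooted (ctr ctrOff ctrOff_mem_box)
open OneStepResolventKernel (Fib LocStencil KInv)
open OneStepKernelFamily (KInvStep decays_KInvStep)
open BalabanStepJetsSucc (wVH wΛ E2 lamCoeffK)
open StepJetData (locStencil_smul)
open BalabanStepJets (lamCoeffOf)
open InterLevelTransport (SLam)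
open Summit.QuantumFields.BalabanUV.Beta.TameKernelCalculus (trK)
open Summit.QuantumFields.BalabanUV.Beta.HessKerDressedUnits (unitS unitS_one locStencil_unitS decays_unitK)
open Summit.QuantumFields.BalabanUV.Beta.AxialDressingRooted (coDressKBmAt one_le_of_neZero)
open Summit.QuantumFields.BalabanUV.Beta.GAN24.CombesThomas (sfStep smStep KStepUnit)
open Summit.QuantumFields.BalabanUV.Beta.GAN24.Push4 (legComp IsFF)
open Summit.QuantumFields.BalabanUV.Beta.GAN24.Push4Iter (legChain)
open Summit.QuantumFields.BalabanUV.Beta.GAN24.Push3 (push₃ isFF_push₃)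
open Summit.QuantumFields.BalabanUV.Beta.GAN24.AffineUnroll (transport transport_zero transport_succ')
open Summit.QuantumFields.BalabanUV.Beta.GAN24.RespStepBmDecompExact (respStepBmSeq)
open Summit.QuantumFields.BalabanUV.Beta.GAN24.RespStepBm (respStepBm e3K_coDressKBmAt_KStepUnit)
open Summit.QuantumFields.BalabanUV.Beta.GAN24.SrecLinearPartEq (colM rowMM reslot push₃_zero)
open Summit.QuantumFields.BalabanUV.Beta.GAN24.SrecUnits (KStepUnit_eq)
open Summit.QuantumFields.BalabanUV.Beta.GAN24.SrecWilsonSector (isFF_smul)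
open Summit.QuantumFields.BalabanUV.Beta.GAN24.StencilSlotVH (unitS_smul_offDiag vh_unit_factor)
open Summit.QuantumFields.BalabanUV.Beta.GAN24.ThirdJetKernel (e3K)
open Summit.QuantumFields.BalabanUV.Beta.SymCorrectorKernel (psiKS)
open Summit.QuantumFields.BalabanUV.Beta.SymCorrectorFace (slotPsiS slotPsiS_apply slotPsiS_apply_kernel)
open Summit.QuantumFields.BalabanUV.Beta.SymCorrectorSlot (comp_trK_psiKS_inr_left comp_psiKS_inr_right)
open Summit.QuantumFields.BalabanUV.Beta.SymmetrisedStepJets (SymTables)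
open Summit.QuantumFields.BalabanUV.Beta.GAN24.CombTransportThreeLegs (transport_inl_inl)
open Summit.QuantumFields.BalabanUV.Beta.GAN24.CombCubicStepTransport (locStencil_transportPsiS)
open Summit.QuantumFields.BalabanUV.Beta.GAN24.CombWilsonSector (combBornOf)
open Summit.QuantumFields.BalabanUV.Beta.GAN24.CombBornSector (combFreshAt combStepMap combUnitStepMap isFF_combUnitStepMap isLoc_combStepMap isLoc_combFreshAt isLoc_unitS
  unitS_combStepMap unitS_combBornOf_eq_sum transport_combUnitStepMap_succ_eq_push₃)

namespace Summit.QuantumFields.BalabanUV.Beta.GAN24.CombBornBorderLineage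

variable {d : ℕ} {Lc : ℕ} [NeZero Lc]

/-! ## §0 M.51's closed form, re-indexed -/

/-- [folklore] **M.51's CLOSED FORM RE-INDEXED BY BIRTH LEVEL** (any `cΛ`): `unitS_k (combBornOf k) = Σ_{i ∈ range (k+1)} transport combUnitStepMap i (k−i) (unitS_i (combFreshAt i))`
(the (III′) twin of leaf-01's `BornLambdaLineage.unitS_bornSecAt_eq_sum_range`). -/
theorem unitS_combBornOf_eq_sum_range (tabs : SymTables d Lc) (cE cVH cΛ : ℝ) (k : ℕ) :
    unitS (sfStep Lc k) (smStep d Lc k) (combBornOf Lc tabs cE cVH cΛ k)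
      = ∑ i ∈ Finset.range (k + 1), transport (combUnitStepMap Lc cE) i (k - i)
          (unitS (sfStep Lc i) (smStep d Lc i) (combFreshAt tabs cVH cΛ i)) := by
  rw [unitS_combBornOf_eq_sum tabs cE cVH cΛ k, Finset.sum_range_succ', Nat.sub_zero]
  refine (add_comm _ _).trans ?_
  congr 1
  refine Finset.sum_congr rfl fun m _ => ?_
  rw [show k - 1 - m = k - (m + 1) by omega]

/-! ## §1 The V-source in units is the same table at every level -/

section VSource

variable (tabs : SymTables d Lc)

/-- [folklore] The V-source of member `0` (`cΛ = 0`): `combFreshAt tabs cVH 0 0 = cVH • tabs.V`. -/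
theorem combFreshAt_v_zero (cVH : ℝ) : combFreshAt tabs cVH 0 0 = fun κ u => cVH • tabs.V κ u := by
  funext κ u
  simp only [combFreshAt, zero_smul, add_zero]

/-- [folklore] The V-source of member `j+1` (`cΛ = 0`): `combFreshAt tabs cVH 0 (j+1) = (cVH·wVH (j+1)) • tabs.V`. -/
theorem combFreshAt_v_succ (cVH : ℝ) (j : ℕ) : combFreshAt tabs cVH 0 (j + 1) = fun κ u => (cVH * wVH d Lc (j + 1)) • tabs.V κ u := by
  funext κ u
  simp only [combFreshAt, zero_mul, zero_smul, add_zero]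

variable (hVff : ∀ κ u x y (α β : Fin (d + 1)), tabs.V κ u x y (Sum.inl α) (Sum.inl β) = 0)
  (hVmm : ∀ κ u x y (μ ν : Fin (d + 1)), tabs.V κ u x y (Sum.inr μ) (Sum.inr ν) = 0)
include hVff hVmm

/-- NOT IN PRINT; OUR BOOKKEEPING ([folklore]; the (III′) twin of leaf-01's `BornBorderLineage.unitS_freshAt_v`).  **THE V-SOURCE IN ITS OWN UNITS IS `cVH • tabs.V` AT EVERY LEVEL**
for an OFF-DIAGONAL border table (member `0`: asym1's `unitS_one`; member `j+1`: the OWNER's `unitS_smul_offDiag` + `vh_unit_factor` — the weight `wVH (j+1)` against the adopted units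
cancels exactly, as in his `StencilSlotVHRoot.unitS_vhPiece_eq` for `vhSAt ρ`). -/
theorem unitS_combFreshAt_v (cVH : ℝ) : ∀ j : ℕ, unitS (sfStep Lc j) (smStep d Lc j) (combFreshAt tabs cVH 0 j) = fun κ u => cVH • tabs.V κ u
  | 0 => by rw [combFreshAt_v_zero, show sfStep Lc 0 = 1 by simp [sfStep], show smStep d Lc 0 = 1 by simp [smStep], unitS_one]
  | j + 1 => by
    rw [combFreshAt_v_succ, unitS_smul_offDiag _ _ _ tabs.V hVff hVmm]
    have h : (sfStep Lc (j + 1) * smStep d Lc (j + 1))⁻¹ * ((sfStep Lc (j + 1))⁻¹ * (smStep d Lc (j + 1))⁻¹) * (cVH * wVH d Lc (j + 1)) = cVH := by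
      calc (sfStep Lc (j + 1) * smStep d Lc (j + 1))⁻¹ * ((sfStep Lc (j + 1))⁻¹ * (smStep d Lc (j + 1))⁻¹) * (cVH * wVH d Lc (j + 1))
          = cVH * ((sfStep Lc (j + 1) * smStep d Lc (j + 1))⁻¹ * ((sfStep Lc (j + 1))⁻¹ * (smStep d Lc (j + 1))⁻¹) * wVH d Lc (j + 1)) := by ring
        _ = cVH := by rw [vh_unit_factor, mul_one]
    rw [h]

omit hVff hVmm in
/-- NOT IN PRINT; OUR BOOKKEEPING ([folklore]; the (III′) twin of `BornBorderLineage.exists_hX_v`).  **THE BORN V-TABLES ARE LOCAL STENCIL FAMILIES IN THEIR OWN UNITS WITH ONE CONSTANT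
FOR ALL LEVELS, AT EVERY RATE** — the record's letter (LV) `tabs.hV` (locality at every rate), through §1 (off-diagonal border). -/
theorem exists_hX_v (hVff : ∀ κ u x y (α β : Fin (d + 1)), tabs.V κ u x y (Sum.inl α) (Sum.inl β) = 0)
    (hVmm : ∀ κ u x y (μ ν : Fin (d + 1)), tabs.V κ u x y (Sum.inr μ) (Sum.inr ν) = 0) (cVH : ℝ) {δ : ℝ} (hδ : 0 ≤ δ) :
    ∃ C : ℝ, ∀ k : ℕ, LocStencil (unitS (sfStep Lc k) (smStep d Lc k) (combFreshAt tabs cVH 0 k)) (|cVH| * C) δ := by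
  obtain ⟨C, hC⟩ := tabs.hV δ hδ
  exact ⟨C, fun k => by rw [unitS_combFreshAt_v tabs hVff hVmm]; exact locStencil_smul cVH hC⟩

end VSource

/-! ## §2 The fixed transport keeps the border shape; the one-step image of the V-source -/

section Transport

variable {n : ℕ} (hn : 0 < n) {r : Fin (d + 1) → ℕ} (hr : r ∈ box (d + 1) n)
include hn hr

omit [NeZero Lc] in
/-- [folklore] **A TABLE WITH NO FIELD–FIELD BLOCK KEEPS NONE UNDER `𝒯`** (M.46 `transport_inl_inl`: the ff entries of `𝒯 Y` are three `slotPsiS` of `Y`'s ff entries, i.e. of zero). -/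
theorem transport_inl_inl_eq_zero {Y : Fin (d + 1) → Site (d + 1) → MKer (d + 1) (Fib d)} (hff : ∀ κ u x z (α β : Fin (d + 1)), Y κ u x z (Sum.inl α) (Sum.inl β) = 0)
    (κ : Fin (d + 1)) (u x z : Site (d + 1)) (α β : Fin (d + 1)) :
    comp (comp (trK (psiKS r n)) (slotPsiS r n Y κ u)) (psiKS r n) x z (Sum.inl α) (Sum.inl β) = 0 := by
  rw [transport_inl_inl hn hr Y κ u x z α β]
  have h0 : ∀ (α : Fin (d + 1)) (x : Site (d + 1)) (β : Fin (d + 1)) (z : Site (d + 1)), slotPsiS r n Y κ u x z (Sum.inl α) (Sum.inl β) = 0 := by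
    intro α x β z
    rw [slotPsiS_apply_kernel]
    have e : (fun κ' u' => Y κ' u' x z (Sum.inl α) (Sum.inl β)) = fun _ _ => (0 : ℝ) := by funext κ' u'; exact hff κ' u' x z α β
    rw [e, slotPsiS_apply]; simp
  have h1 : ∀ (β : Fin (d + 1)) (z : Site (d + 1)), slotPsiS r n (fun α x => slotPsiS r n Y κ u x z (Sum.inl α) (Sum.inl β)) α x = 0 := by
    intro β z
    have e : (fun α x => slotPsiS r n Y κ u x z (Sum.inl α) (Sum.inl β)) = fun _ _ => (0 : ℝ) := by funext α' x'; exact h0 α' x' β z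
    rw [e, slotPsiS_apply]; simp
  have e : (fun β z => slotPsiS r n (fun α x => slotPsiS r n Y κ u x z (Sum.inl α) (Sum.inl β)) α x) = fun _ _ => (0 : ℝ) := by funext β' z'; exact h1 β' z'
  rw [e, slotPsiS_apply]; simp

omit [NeZero Lc] hn hr in
/-- [folklore] **THE MULTIPLIER–MULTIPLIER BLOCK IS ONLY SLOT-TRANSPORTED** (`Ψ̂`'s multiplier legs are the identity: d1-leaf-03's `comp_psiKS_inr_right ∕ comp_trK_psiKS_inr_left`), hence a
table with no mm block keeps none under `𝒯`. -/
theorem transport_inr_inr_eq_zero {Y : Fin (d + 1) → Site (d + 1) → MKer (d + 1) (Fib d)} (hmm : ∀ κ u x z (μ ν : Fin (d + 1)), Y κ u x z (Sum.inr μ) (Sum.inr ν) = 0)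
    (κ : Fin (d + 1)) (u x z : Site (d + 1)) (μ ν : Fin (d + 1)) :
    comp (comp (trK (psiKS r n)) (slotPsiS r n Y κ u)) (psiKS r n) x z (Sum.inr μ) (Sum.inr ν) = 0 := by
  rw [comp_psiKS_inr_right, comp_trK_psiKS_inr_left, slotPsiS_apply_kernel]
  have e : (fun κ' u' => Y κ' u' x z (Sum.inr μ) (Sum.inr ν)) = fun _ _ => (0 : ℝ) := by funext κ' u'; exact hmm κ' u' x z μ ν
  rw [e, slotPsiS_apply]; simp

omit [NeZero Lc] in
/-- [folklore] The transported off-diagonal table has no field–field channel (`reslot inl inl = 0`). -/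
theorem reslot_inl_inl_transport {Y : Fin (d + 1) → Site (d + 1) → MKer (d + 1) (Fib d)} (hff : ∀ κ u x z (α β : Fin (d + 1)), Y κ u x z (Sum.inl α) (Sum.inl β) = 0) :
    reslot Sum.inl Sum.inl (fun κ u => comp (comp (trK (psiKS r n)) (slotPsiS r n Y κ u)) (psiKS r n)) = fun _ _ => 0 := by
  funext κ u x z a b
  rcases a with κ₁ | μ <;> rcases b with κ₂ | ν <;> simp [reslot, transport_inl_inl_eq_zero hn hr hff]

omit [NeZero Lc] hn hr in
/-- [folklore] The transported off-diagonal table has no multiplier–multiplier channel (`reslot inr inr = 0`). -/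
theorem reslot_inr_inr_transport {Y : Fin (d + 1) → Site (d + 1) → MKer (d + 1) (Fib d)} (hmm : ∀ κ u x z (μ ν : Fin (d + 1)), Y κ u x z (Sum.inr μ) (Sum.inr ν) = 0) :
    reslot Sum.inr Sum.inr (fun κ u => comp (comp (trK (psiKS r n)) (slotPsiS r n Y κ u)) (psiKS r n)) = fun _ _ => 0 := by
  funext κ u x z a b
  rcases a with κ₁ | μ <;> rcases b with κ₂ | ν <;> simp [reslot, transport_inr_inr_eq_zero (r := r) (n := n) hmm]

end Transport

section Image

variable (tabs : SymTables d Lc) (hVff : ∀ κ u x y (α β : Fin (d + 1)), tabs.V κ u x y (Sum.inl α) (Sum.inl β) = 0)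
  (hVmm : ∀ κ u x y (μ ν : Fin (d + 1)), tabs.V κ u x y (Sum.inr μ) (Sum.inr ν) = 0)
include hVff hVmm

/-- NOT IN PRINT; OUR BOOKKEEPING ([folklore]; the (III′) twin of leaf-01's `BornBorderLineage.unitStepMap_v_eq_two_push₃`).  **THE ONE-STEP IMAGE OF THE V-SOURCE IS THE TWO MIXED
CHANNELS OF THE FOUR-CHANNEL READ ON THE TRANSPORTED TABLE**: with `R_i = respStepBm ρ_c Lc (Lc^i) (Lc^(i+1))` (ONE dressed step at the centred root) and `K̃_i = KStepUnit Lc i`,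
`combUnitStepMap Lc cE i (cVH • tabs.V) = c₃ • (−(push₃ (−R_i) (colM K̃_i Lc) R_i (reslot inl inr (𝒯 (cVH • V))) + push₃ (rowMM K̃_i Lc) R_i R_i (reslot inr inl (𝒯 (cVH • V)))))` —
leaf-01 g43's `RespStepBm.e3K_coDressKBmAt_KStepUnit` on `𝒯 (cVH • V)` (local: M.43 `locStencil_transportPsiS` over (LV)); the ff and mm channels vanish because the border table's do
and `𝒯` keeps that (§2). -/
theorem combUnitStepMap_v_eq_two_push₃ (cE cVH : ℝ) (i : ℕ) :
    combUnitStepMap Lc cE i (fun κ u => cVH • tabs.V κ u) = fun κ' u' =>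
      (cE * (Lc : ℝ) ^ (2 * (d + 1))) •
        -(push₃ (-respStepBm (ctr (d + 1) Lc) Lc (Lc ^ i) (Lc ^ (i + 1))) (colM (KStepUnit (d := d) Lc i) Lc)
              (respStepBm (ctr (d + 1) Lc) Lc (Lc ^ i) (Lc ^ (i + 1)))
              (reslot Sum.inl Sum.inr fun κ u => comp (comp (trK (psiKS (ctrOff (d + 1) Lc) Lc))
                (slotPsiS (ctrOff (d + 1) Lc) Lc (fun κ u => cVH • tabs.V κ u) κ u)) (psiKS (ctrOff (d + 1) Lc) Lc)) κ' u'
          + push₃ (rowMM (KStepUnit (d := d) Lc i) Lc) (respStepBm (ctr (d + 1) Lc) Lc (Lc ^ i) (Lc ^ (i + 1)))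
              (respStepBm (ctr (d + 1) Lc) Lc (Lc ^ i) (Lc ^ (i + 1)))
              (reslot Sum.inr Sum.inl fun κ u => comp (comp (trK (psiKS (ctrOff (d + 1) Lc) Lc))
                (slotPsiS (ctrOff (d + 1) Lc) Lc (fun κ u => cVH • tabs.V κ u) κ u)) (psiKS (ctrOff (d + 1) Lc) Lc)) κ' u') := by
  have hLc : 1 ≤ Lc := one_le_of_neZero Lc
  have hr : ctrOff (d + 1) Lc ∈ box (d + 1) Lc := ctrOff_mem_box hLc
  -- the unit step resolvent decays per level
  obtain ⟨m, CK, hm, -, hK0⟩ := decays_KInvStep (d := d) (Lc := Lc) i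
  obtain ⟨C, hK⟩ : ∃ C, Decays (KStepUnit (d := d) Lc i) C m := ⟨_, by rw [KStepUnit_eq]; exact decays_unitK hK0⟩
  -- the transported V-source is localised
  obtain ⟨CV, hV1⟩ := tabs.hV 1 zero_le_one
  obtain ⟨CT, δT, hδT, hT⟩ := locStencil_transportPsiS hLc hr (locStencil_smul cVH hV1) one_pos
  -- the transported V-source is still off-diagonal
  have hffc : ∀ κ u x z (α β : Fin (d + 1)), (cVH • tabs.V κ u) x z (Sum.inl α) (Sum.inl β) = 0 := fun κ u x z α β => by
    rw [Pi.smul_apply, Pi.smul_apply, Pi.smul_apply, Pi.smul_apply, hVff, smul_zero]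
  have hmmc : ∀ κ u x z (μ ν : Fin (d + 1)), (cVH • tabs.V κ u) x z (Sum.inr μ) (Sum.inr ν) = 0 := fun κ u x z μ ν => by
    rw [Pi.smul_apply, Pi.smul_apply, Pi.smul_apply, Pi.smul_apply, hVmm, smul_zero]
  funext κ' u'
  -- leaf-01 g43's four-channel read at the centred root (`ctr (d+1) Lc = toSite (ctrOff (d+1) Lc)` by `rfl`)
  have e3 : e3K (coDressKBmAt (ctr (d + 1) Lc) Lc (KStepUnit (d := d) Lc i)) Lc
      (fun κ u => comp (comp (trK (psiKS (ctrOff (d + 1) Lc) Lc)) (slotPsiS (ctrOff (d + 1) Lc) Lc (fun κ u => cVH • tabs.V κ u) κ u)) (psiKS (ctrOff (d + 1) Lc) Lc)) κ' u'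
      = -(push₃ (-respStepBm (ctr (d + 1) Lc) Lc (Lc ^ i) (Lc ^ (i + 1))) (respStepBm (ctr (d + 1) Lc) Lc (Lc ^ i) (Lc ^ (i + 1)))
              (respStepBm (ctr (d + 1) Lc) Lc (Lc ^ i) (Lc ^ (i + 1)))
              (reslot Sum.inl Sum.inl fun κ u => comp (comp (trK (psiKS (ctrOff (d + 1) Lc) Lc))
                (slotPsiS (ctrOff (d + 1) Lc) Lc (fun κ u => cVH • tabs.V κ u) κ u)) (psiKS (ctrOff (d + 1) Lc) Lc)) κ' u'
          + push₃ (-respStepBm (ctr (d + 1) Lc) Lc (Lc ^ i) (Lc ^ (i + 1))) (colM (KStepUnit (d := d) Lc i) Lc)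
              (respStepBm (ctr (d + 1) Lc) Lc (Lc ^ i) (Lc ^ (i + 1)))
              (reslot Sum.inl Sum.inr fun κ u => comp (comp (trK (psiKS (ctrOff (d + 1) Lc) Lc))
                (slotPsiS (ctrOff (d + 1) Lc) Lc (fun κ u => cVH • tabs.V κ u) κ u)) (psiKS (ctrOff (d + 1) Lc) Lc)) κ' u'
          + push₃ (rowMM (KStepUnit (d := d) Lc i) Lc) (respStepBm (ctr (d + 1) Lc) Lc (Lc ^ i) (Lc ^ (i + 1)))
              (respStepBm (ctr (d + 1) Lc) Lc (Lc ^ i) (Lc ^ (i + 1)))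
              (reslot Sum.inr Sum.inl fun κ u => comp (comp (trK (psiKS (ctrOff (d + 1) Lc) Lc))
                (slotPsiS (ctrOff (d + 1) Lc) Lc (fun κ u => cVH • tabs.V κ u) κ u)) (psiKS (ctrOff (d + 1) Lc) Lc)) κ' u'
          + push₃ (rowMM (KStepUnit (d := d) Lc i) Lc) (colM (KStepUnit (d := d) Lc i) Lc)
              (respStepBm (ctr (d + 1) Lc) Lc (Lc ^ i) (Lc ^ (i + 1)))
              (reslot Sum.inr Sum.inr fun κ u => comp (comp (trK (psiKS (ctrOff (d + 1) Lc) Lc))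
                (slotPsiS (ctrOff (d + 1) Lc) Lc (fun κ u => cVH • tabs.V κ u) κ u)) (psiKS (ctrOff (d + 1) Lc) Lc)) κ' u') :=
    e3K_coDressKBmAt_KStepUnit hr hK hm hT hδT κ' u'
  show (cE * (Lc : ℝ) ^ (2 * (d + 1))) • e3K _ _ _ κ' u' = _
  rw [e3, reslot_inl_inl_transport hLc hr (Y := fun κ u => cVH • tabs.V κ u) hffc,
    reslot_inr_inr_transport (n := Lc) (r := ctrOff (d + 1) Lc) (Y := fun κ u => cVH • tabs.V κ u) hmmc, push₃_zero, push₃_zero, zero_add, add_zero]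

omit hVff hVmm in
/-- [folklore] The one-step image of the V-source is ff-valued (M.51 `isFF_combUnitStepMap`, any table). -/
theorem isFF_combUnitStepMap_v (cE cVH : ℝ) (i : ℕ) (κ : Fin (d + 1)) (u : Site (d + 1)) :
    IsFF (combUnitStepMap Lc cE i (fun κ u => cVH • tabs.V κ u) κ u) :=
  isFF_combUnitStepMap Lc cE i _ κ u

/-- [folklore] The one-step image of the V-source is in the class of local stencil families (M.51 `unitS_combStepMap` backwards + `isLoc_combStepMap` + `isLoc_unitS`). -/
theorem isLoc_combUnitStepMap_v (cE cVH : ℝ) (i : ℕ) :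
    ∃ Cs δ : ℝ, 0 < δ ∧ LocStencil (combUnitStepMap Lc cE i (fun κ u => cVH • tabs.V κ u)) Cs δ := by
  rw [← unitS_combFreshAt_v tabs hVff hVmm cVH i, ← unitS_combStepMap cE i (isLoc_combFreshAt tabs cE cVH 0 i)]
  exact isLoc_unitS _ _ (isLoc_combStepMap cE i (isLoc_combFreshAt tabs cE cVH 0 i))

/-! ## §3 The V-born remainder in units: the fresh source plus the transported one-step images -/

/-- NOT IN PRINT; OUR BOOKKEEPING ([folklore]; the (III′) twin of leaf-01's `BornBorderLineage.unitS_bornV_eq_sum`).  **THE (III′) V-BORN REMAINDER, MEMBER `k`, IN THE ADOPTED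
UNITS**: `unitS_k (combBornOf Lc tabs cE cVH 0 k) = cVH • tabs.V + Σ_{i<k} transport combUnitStepMap (i+1) (k−1−i) X_i`, `X_i := combUnitStepMap Lc cE i (cVH • tabs.V)` (§2) — the fresh
source (the same table at every level, §1) plus every earlier source pushed ONE step at its birth level and then transported from the next level. -/
theorem unitS_combBornV_eq_sum (cE cVH : ℝ) (k : ℕ) :
    unitS (sfStep Lc k) (smStep d Lc k) (combBornOf Lc tabs cE cVH 0 k)
      = (fun κ u => cVH • tabs.V κ u)
        + ∑ i ∈ Finset.range k, transport (combUnitStepMap Lc cE) (i + 1) (k - 1 - i)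
            (combUnitStepMap Lc cE i (fun κ u => cVH • tabs.V κ u)) := by
  rw [unitS_combBornOf_eq_sum_range tabs cE cVH 0 k, Finset.sum_range_succ, Nat.sub_self, transport_zero, unitS_combFreshAt_v tabs hVff hVmm]
  refine (add_comm _ _).trans ?_
  congr 1
  refine Finset.sum_congr rfl fun i hi => ?_
  have hik : i < k := Finset.mem_range.1 hi
  rw [unitS_combFreshAt_v tabs hVff hVmm, show k - i = (k - 1 - i) + 1 by omega, transport_succ']

/-- NOT IN PRINT; OUR BOOKKEEPING ([folklore]; the (III′) twin of `BornBorderLineage.unitS_bornV_eq_sum_push₃`).  **THE SAME WITH EVERY TRANSPORT OF `≥ 1` STEP WRITTEN AS ONE THREE-LEG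
PUSH THROUGH THE CONJUGATED DRESSED LEG CHAIN FROM THE NEXT LEVEL** (M.51 `transport_combUnitStepMap_succ_eq_push₃` at base `i+1`; the one-step image is ff-valued and local, §2):
`unitS_{k+1} (combBornOf Lc tabs cE cVH 0 (k+1)) = cVH • tabs.V + X_k + Σ_{i<k} c₃^{k−i} • push₃ T″_i T″_i T″_i X_i`, `T″_i = legChain (fun j ↦ legComp ψ♭ R_j) (i+1) (k−1−i)` — the (E)
display with `R_j ↦ legComp ψ♭ R_j` in every leg and `vhSAt ρ ↦ tabs.V` (through `𝒯`) in the source. -/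
theorem unitS_combBornV_eq_sum_push₃ (cE cVH : ℝ) (k : ℕ) :
    unitS (sfStep Lc (k + 1)) (smStep d Lc (k + 1)) (combBornOf Lc tabs cE cVH 0 (k + 1))
      = (fun κ u => cVH • tabs.V κ u)
        + combUnitStepMap Lc cE k (fun κ u => cVH • tabs.V κ u)
        + ∑ i ∈ Finset.range k, fun κ' u' => (cE * (Lc : ℝ) ^ (2 * (d + 1))) ^ (k - i) •
            push₃
              (legChain (fun j => legComp (fun α x κ u => psiKS (ctrOff (d + 1) Lc) Lc u x (Sum.inl κ) (Sum.inl α)) (respStepBmSeq (ctr (d + 1) Lc) Lc j)) (i + 1) (k - 1 - i))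
              (legChain (fun j => legComp (fun α x κ u => psiKS (ctrOff (d + 1) Lc) Lc u x (Sum.inl κ) (Sum.inl α)) (respStepBmSeq (ctr (d + 1) Lc) Lc j)) (i + 1) (k - 1 - i))
              (legChain (fun j => legComp (fun α x κ u => psiKS (ctrOff (d + 1) Lc) Lc u x (Sum.inl κ) (Sum.inl α)) (respStepBmSeq (ctr (d + 1) Lc) Lc j)) (i + 1) (k - 1 - i))
              (combUnitStepMap Lc cE i (fun κ u => cVH • tabs.V κ u)) κ' u' := by
  rw [unitS_combBornV_eq_sum tabs hVff hVmm cE cVH (k + 1), Finset.sum_range_succ, show k + 1 - 1 - k = 0 by omega, transport_zero, add_assoc]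
  congr 1
  refine (add_comm _ _).trans ?_
  congr 1
  refine Finset.sum_congr rfl fun i hi => ?_
  have hik : i < k := Finset.mem_range.1 hi
  obtain ⟨n, hn⟩ : ∃ n, k + 1 - 1 - i = n + 1 := ⟨k - 1 - i, by omega⟩
  have hn' : k - i = n + 1 := by omega
  have hn'' : k - 1 - i = n := by omega
  rw [hn, hn', hn'', transport_combUnitStepMap_succ_eq_push₃ cE (i + 1) (fun κ u => isFF_combUnitStepMap_v tabs cE cVH i κ u)
    (isLoc_combUnitStepMap_v tabs hVff hVmm cE cVH i) n]

end Image

end Summit.QuantumFields.BalabanUV.Beta.GAN24.CombBornBorderLineage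

end
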